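import Literature.Analysis.InnerProduct.FiniteRankDowndate

/-!
# Multi-driver secular excess: the negative eigenvalue of a finite-rank downdate is the
# capacitance EXCESS form at the moment vector (arrival law for several drivers)

Topic `Literature/Analysis/InnerProduct` (companion of `FiniteRankDowndate` and of `SecularExcess`,
the case of ONE driver). Let `A` be a symmetric operator on a real inner product space with
nonnegative form, `v : ι → E` finitely many DRIVERS, `Q = A − ∑ᵢ |vᵢ⟩⟨vᵢ|` the downdate,
`zᵢ` witnesses `A zᵢ = vᵢ` (`zᵢ = A⁻¹ vᵢ`), so that `M = (⟪vᵢ, zⱼ⟫)ᵢⱼ = Vᵀ A⁻¹ V` is the capacitance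
matrix and `Ex(c) := ∑ᵢ ∑ⱼ cᵢ cⱼ ⟪vᵢ, zⱼ⟫ − ∑ᵢ cᵢ² = cᵀ(M − I)c` its EXCESS form
(`finiteRank_downdate_negSubspace_iff`: `n₋(Q) = #{eigenvalues of M above 1}`). For an eigenpair
`A u − ∑ᵢ ⟪vᵢ, u⟫ vᵢ = −ε u` with MOMENT VECTOR `cᵢ := ⟪vᵢ, u⟫` and the combined witness
`Z c := ∑ⱼ cⱼ zⱼ` this file records, dimension-free and with the `zᵢ` as hypotheses (no inverses,
no spectral theorem, no resolvent vectors needed):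

* `finiteRank_downdate_moment_row_eq` — pairing the eigen-equation with `zⱼ`:
  `∑ᵢ cᵢ ⟪vᵢ, zⱼ⟫ = cⱼ + ε ⟪u, zⱼ⟫` (row `j` of `M c = c + ε Zᵀu`).
* `finiteRank_downdate_excess_eq` — the EXCESS IDENTITY `Ex(c) = ε ⟪u, Z c⟫`
  (one driver: `⟪v,u⟫² (vᵀA⁻¹v − 1) = ε ⟪u, ⟪v,u⟫ z⟫`, i.e. `SecularExcess`'s `s − 1 = ε ⟪y, z⟫`).
* `finiteRank_downdate_apply_witnessSum_sub` — `A (Z c − u) = ε u`; hence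
  `finiteRank_downdate_inner_self_le_inner_witnessSum` (`⟪u, u⟫ ≤ ⟪u, Z c⟫`, for `0 < ε`) and
  `finiteRank_downdate_inner_witnessSum_le_self` (`⟪u, Z c⟫ ≤ ⟪Z c, Z c⟫`, for `0 ≤ ε`).
* `finiteRank_downdate_excess_two_sided` — the TWO-SIDED ARRIVAL LAW
  `ε ‖u‖² ≤ Ex(c) ≤ ε ‖Z c‖²`: a negative eigenvalue `−ε` of the downdate is the capacitance excess
  at its own moment vector divided by a squared length between `‖u‖²` and `‖A⁻¹V c‖²`; in
  particular `Ex(c) ≥ 0` at the moment vector of every nonpositive eigenvalue, and `−ε` is born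
  continuously where an eigenvalue of `M` crosses `1`.
* `finiteRank_downdate_sum_sq_moment_eq` — `∑ᵢ cᵢ² = ⟪A u, u⟫ + ε ‖u‖²` (pairing with `u`), and
  `finiteRank_downdate_eig_mul_inner_self_le` — if `Ex ≤ (μ − 1)|c|²` on all of `ι → ℝ`
  (`λ_max(M) ≤ μ`) then `ε ‖u‖² ≤ (μ − 1) ∑ᵢ ⟪vᵢ, u⟫²`.

These are the block (rank-`m`) versions of the secular-equation facts behind
`SecularExcess` [Golub–Van Loan, *Matrix Computations* 4th ed., §8.4.3, Thm 8.4.3 for `m = 1`;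
Arbenz–Golub 1988 for general `m`; the capacitance matrix `I − VᵀA⁻¹V` is the Schur complement of
the Sherman–Morrison–Woodbury / Haynsworth bordered matrix, Horn–Johnson Thm 7.7.7].
-/

noncomputable section

open scoped InnerProductSpace RealInnerProductSpace BigOperators

namespace Literature.Analysis.InnerProduct

variable {E : Type*} [NormedAddCommGroup E] [InnerProductSpace ℝ E]
variable {ι : Type*} [Fintype ι]

/-- Row `j` of the moment system: pairing the eigen-equation `A u − ∑ᵢ ⟪vᵢ,u⟫ vᵢ = −ε u` of the
downdate with a witness `zⱼ`, `A zⱼ = vⱼ`, gives `∑ᵢ ⟪vᵢ,u⟫ ⟪vᵢ,zⱼ⟫ = ⟪vⱼ,u⟫ + ε ⟪u,zⱼ⟫`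
(`M c = c + ε Zᵀ u` for the capacitance matrix `M = VᵀA⁻¹V`). [folklore] -/
theorem finiteRank_downdate_moment_row_eq (A : E →ₗ[ℝ] E)
    (hsym : ∀ x y : E, ⟪A x, y⟫_ℝ = ⟪x, A y⟫_ℝ) {v z : ι → E} {u : E} {ε : ℝ}
    (hu : A u - ∑ i, ⟪v i, u⟫_ℝ • v i = -(ε • u)) (hz : ∀ i, A (z i) = v i) (j : ι) :
    ∑ i, ⟪v i, u⟫_ℝ * ⟪v i, z j⟫_ℝ = ⟪v j, u⟫_ℝ + ε * ⟪u, z j⟫_ℝ := by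
  classical
  have h := congrArg (fun w : E => ⟪w, z j⟫_ℝ) hu
  simp only [inner_sub_left, sum_inner, real_inner_smul_left, inner_neg_left] at h
  rw [hsym, hz j, real_inner_comm (v j) u] at h
  linarith

/-- **Excess identity** (multi-driver arrival law, exact form): for an eigenpair
`A u − ∑ᵢ ⟪vᵢ,u⟫ vᵢ = −ε u` of the downdate and witnesses `A zⱼ = vⱼ`, the capacitance EXCESS form
at the moment vector `cᵢ = ⟪vᵢ,u⟫` equals `ε` times the pairing of `u` with the combined witness:
`∑ᵢ∑ⱼ cᵢcⱼ⟪vᵢ,zⱼ⟫ − ∑ᵢ cᵢ² = ε ⟪u, ∑ⱼ cⱼ zⱼ⟫`. [cite: ArbenzGolub1988, block secular equation] -/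
theorem finiteRank_downdate_excess_eq (A : E →ₗ[ℝ] E)
    (hsym : ∀ x y : E, ⟪A x, y⟫_ℝ = ⟪x, A y⟫_ℝ) {v z : ι → E} {u : E} {ε : ℝ}
    (hu : A u - ∑ i, ⟪v i, u⟫_ℝ • v i = -(ε • u)) (hz : ∀ i, A (z i) = v i) :
    ∑ i, ∑ j, ⟪v i, u⟫_ℝ * ⟪v j, u⟫_ℝ * ⟪v i, z j⟫_ℝ - ∑ i, ⟪v i, u⟫_ℝ ^ 2
      = ε * ⟪u, ∑ j, ⟪v j, u⟫_ℝ • z j⟫_ℝ := by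
  classical
  have hrow := fun j => finiteRank_downdate_moment_row_eq A hsym hu hz j
  have h1 : ∑ i, ∑ j, ⟪v i, u⟫_ℝ * ⟪v j, u⟫_ℝ * ⟪v i, z j⟫_ℝ
      = ∑ j, ⟪v j, u⟫_ℝ * (∑ i, ⟪v i, u⟫_ℝ * ⟪v i, z j⟫_ℝ) := by
    rw [Finset.sum_comm]
    refine Finset.sum_congr rfl fun j _ => ?_
    rw [Finset.mul_sum]
    exact Finset.sum_congr rfl fun i _ => by ring
  have h2 : ∑ j, ⟪v j, u⟫_ℝ * (∑ i, ⟪v i, u⟫_ℝ * ⟪v i, z j⟫_ℝ)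
      = ∑ j, ⟪v j, u⟫_ℝ ^ 2 + ε * ∑ j, ⟪v j, u⟫_ℝ * ⟪u, z j⟫_ℝ := by
    rw [Finset.mul_sum, ← Finset.sum_add_distrib]
    exact Finset.sum_congr rfl fun j _ => by rw [hrow j]; ring
  rw [h1, h2, inner_sum]
  simp_rw [real_inner_smul_right]
  ring

/-- The combined witness minus the eigenvector is mapped by `A` onto `ε u`:
`A (∑ⱼ ⟪vⱼ,u⟫ zⱼ − u) = ε u`. [folklore] -/
theorem finiteRank_downdate_apply_witnessSum_sub (A : E →ₗ[ℝ] E) {v z : ι → E} {u : E} {ε : ℝ}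
    (hu : A u - ∑ i, ⟪v i, u⟫_ℝ • v i = -(ε • u)) (hz : ∀ i, A (z i) = v i) :
    A (∑ j, ⟪v j, u⟫_ℝ • z j - u) = ε • u := by
  classical
  have hAu : A u = -(ε • u) + ∑ i, ⟪v i, u⟫_ℝ • v i := (sub_eq_iff_eq_add).mp hu
  rw [map_sub, map_sum, hAu]
  simp_rw [map_smul, hz]
  abel

/-- `⟪u, u⟫ ≤ ⟪u, ∑ⱼ ⟪vⱼ,u⟫ zⱼ⟫` for an eigenpair with `−ε < 0`: with `d = Z c − u`,
`ε ⟪u, d⟫ = ⟪A d, d⟫ ≥ 0`. [folklore] -/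
theorem finiteRank_downdate_inner_self_le_inner_witnessSum (A : E →ₗ[ℝ] E)
    (hpos : ∀ x : E, 0 ≤ ⟪A x, x⟫_ℝ) {v z : ι → E} {u : E} {ε : ℝ} (hε : 0 < ε)
    (hu : A u - ∑ i, ⟪v i, u⟫_ℝ • v i = -(ε • u)) (hz : ∀ i, A (z i) = v i) :
    ⟪u, u⟫_ℝ ≤ ⟪u, ∑ j, ⟪v j, u⟫_ℝ • z j⟫_ℝ := by
  classical
  have hd := finiteRank_downdate_apply_witnessSum_sub A hu hz
  have h := hpos (∑ j, ⟪v j, u⟫_ℝ • z j - u)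
  rw [hd, real_inner_smul_left, inner_sub_right] at h
  have h0 := (mul_nonneg_iff_of_pos_left hε).mp h
  linarith

/-- `⟪u, Z c⟫ ≤ ⟪Z c, Z c⟫` (`Z c = ∑ⱼ ⟪vⱼ,u⟫ zⱼ`) for an eigenpair with `−ε ≤ 0`: with
`d = Z c − u`, `⟪d, Z c⟫ = ⟪d, u⟫ + ‖d‖²` and `ε ⟪d, u⟫ = ⟪A d, d⟫ ≥ 0`. [folklore] -/
theorem finiteRank_downdate_inner_witnessSum_le_self (A : E →ₗ[ℝ] E)
    (hpos : ∀ x : E, 0 ≤ ⟪A x, x⟫_ℝ) {v z : ι → E} {u : E} {ε : ℝ} (hε : 0 ≤ ε)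
    (hu : A u - ∑ i, ⟪v i, u⟫_ℝ • v i = -(ε • u)) (hz : ∀ i, A (z i) = v i) :
    ε * ⟪u, ∑ j, ⟪v j, u⟫_ℝ • z j⟫_ℝ ≤ ε * ⟪∑ j, ⟪v j, u⟫_ℝ • z j, ∑ j, ⟪v j, u⟫_ℝ • z j⟫_ℝ := by
  classical
  set w : E := ∑ j, ⟪v j, u⟫_ℝ • z j with hw
  have hd := finiteRank_downdate_apply_witnessSum_sub A hu hz
  have h := hpos (w - u)
  rw [← hw] at hd
  rw [hd, real_inner_smul_left, inner_sub_right] at h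
  have h2 : 0 ≤ ⟪w - u, w - u⟫_ℝ := real_inner_self_nonneg
  rw [inner_sub_left, inner_sub_right, inner_sub_right] at h2
  have h3 : ⟪w, u⟫_ℝ = ⟪u, w⟫_ℝ := real_inner_comm u w
  nlinarith [mul_nonneg hε h2]

/-- **Two-sided multi-driver arrival law**: for an eigenpair `A u − ∑ᵢ ⟪vᵢ,u⟫ vᵢ = −ε u` with
`0 < ε` of the downdate of a nonnegative symmetric `A`, and witnesses `A zⱼ = vⱼ`,
`ε ‖u‖² ≤ ∑ᵢ∑ⱼ cᵢcⱼ⟪vᵢ,zⱼ⟫ − ∑ᵢ cᵢ² ≤ ε ‖∑ⱼ cⱼ zⱼ‖²` (`cᵢ = ⟪vᵢ,u⟫`): the negative eigenvalue is the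
capacitance excess `cᵀ(VᵀA⁻¹V − I)c` at its own moment vector over a squared length between `‖u‖²`
and `‖A⁻¹Vc‖²`. One driver: `SecularExcess`'s `ε‖y‖² ≤ vᵀA⁻¹v − 1 ≤ ε‖z‖²`.
[cite: GolubVanLoan2013, Thm 8.4.3; ArbenzGolub1988, block secular equation] -/
theorem finiteRank_downdate_excess_two_sided (A : E →ₗ[ℝ] E)
    (hsym : ∀ x y : E, ⟪A x, y⟫_ℝ = ⟪x, A y⟫_ℝ) (hpos : ∀ x : E, 0 ≤ ⟪A x, x⟫_ℝ)
    {v z : ι → E} {u : E} {ε : ℝ} (hε : 0 < ε)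
    (hu : A u - ∑ i, ⟪v i, u⟫_ℝ • v i = -(ε • u)) (hz : ∀ i, A (z i) = v i) :
    ε * ⟪u, u⟫_ℝ ≤ ∑ i, ∑ j, ⟪v i, u⟫_ℝ * ⟪v j, u⟫_ℝ * ⟪v i, z j⟫_ℝ - ∑ i, ⟪v i, u⟫_ℝ ^ 2 ∧
      ∑ i, ∑ j, ⟪v i, u⟫_ℝ * ⟪v j, u⟫_ℝ * ⟪v i, z j⟫_ℝ - ∑ i, ⟪v i, u⟫_ℝ ^ 2
        ≤ ε * ⟪∑ j, ⟪v j, u⟫_ℝ • z j, ∑ j, ⟪v j, u⟫_ℝ • z j⟫_ℝ := by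
  rw [finiteRank_downdate_excess_eq A hsym hu hz]
  exact ⟨mul_le_mul_of_nonneg_left
      (finiteRank_downdate_inner_self_le_inner_witnessSum A hpos hε hu hz) hε.le,
    finiteRank_downdate_inner_witnessSum_le_self A hpos hε.le hu hz⟩

/-- The excess form is nonnegative at the moment vector of every eigenpair with eigenvalue
`−ε ≤ 0`: `0 ≤ ∑ᵢ∑ⱼ cᵢcⱼ⟪vᵢ,zⱼ⟫ − ∑ᵢ cᵢ²` (it equals `ε ⟪u, Zc⟫ ≥ ε ‖u‖² ≥ 0`). [folklore] -/
theorem finiteRank_downdate_excess_nonneg (A : E →ₗ[ℝ] E)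
    (hsym : ∀ x y : E, ⟪A x, y⟫_ℝ = ⟪x, A y⟫_ℝ) (hpos : ∀ x : E, 0 ≤ ⟪A x, x⟫_ℝ)
    {v z : ι → E} {u : E} {ε : ℝ} (hε : 0 ≤ ε)
    (hu : A u - ∑ i, ⟪v i, u⟫_ℝ • v i = -(ε • u)) (hz : ∀ i, A (z i) = v i) :
    0 ≤ ∑ i, ∑ j, ⟪v i, u⟫_ℝ * ⟪v j, u⟫_ℝ * ⟪v i, z j⟫_ℝ - ∑ i, ⟪v i, u⟫_ℝ ^ 2 := by
  classical
  rw [finiteRank_downdate_excess_eq A hsym hu hz]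
  have hd := finiteRank_downdate_apply_witnessSum_sub A hu hz
  have h := hpos (∑ j, ⟪v j, u⟫_ℝ • z j - u)
  rw [hd, real_inner_smul_left, inner_sub_right] at h
  have h1 : 0 ≤ ε * ⟪u, u⟫_ℝ := mul_nonneg hε real_inner_self_nonneg
  linarith

/-- Pairing the eigen-equation with `u`: `∑ᵢ ⟪vᵢ,u⟫² = ⟪A u, u⟫ + ε ⟪u, u⟫` (the squared moment vector
is the remainder's Rayleigh quotient plus `ε`). [folklore] -/
theorem finiteRank_downdate_sum_sq_moment_eq (A : E →ₗ[ℝ] E) {v : ι → E} {u : E} {ε : ℝ}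
    (hu : A u - ∑ i, ⟪v i, u⟫_ℝ • v i = -(ε • u)) :
    ∑ i, ⟪v i, u⟫_ℝ ^ 2 = ⟪A u, u⟫_ℝ + ε * ⟪u, u⟫_ℝ := by
  classical
  have h := congrArg (fun w : E => ⟪w, u⟫_ℝ) hu
  simp only [inner_sub_left, sum_inner, real_inner_smul_left, inner_neg_left] at h
  have h2 : ∑ i, ⟪v i, u⟫_ℝ ^ 2 = ∑ i, ⟪v i, u⟫_ℝ * ⟪v i, u⟫_ℝ :=
    Finset.sum_congr rfl fun i _ => by ring
  rw [h2]
  linarith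

/-- **Eigenvalue bound by the top of the capacitance spectrum**: if the excess form is bounded by
`(μ − 1)|c|²` on coefficient space (`λ_max(VᵀA⁻¹V) ≤ μ`), then every eigenpair with `−ε < 0`
satisfies `ε ‖u‖² ≤ (μ − 1) ∑ᵢ ⟪vᵢ,u⟫²` (`= (μ − 1)(⟪A u,u⟫ + ε‖u‖²)`); for one driver this is
`SecularExcess`'s `ε ≤ (vᵀA⁻¹v − 1) ⟪v,u⟫²`. [cite: ArbenzGolub1988, block secular equation] -/
theorem finiteRank_downdate_eig_mul_inner_self_le (A : E →ₗ[ℝ] E)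
    (hsym : ∀ x y : E, ⟪A x, y⟫_ℝ = ⟪x, A y⟫_ℝ) (hpos : ∀ x : E, 0 ≤ ⟪A x, x⟫_ℝ)
    {v z : ι → E} {u : E} {ε μ : ℝ} (hε : 0 < ε)
    (hu : A u - ∑ i, ⟪v i, u⟫_ℝ • v i = -(ε • u)) (hz : ∀ i, A (z i) = v i)
    (hμ : ∀ c : ι → ℝ, ∑ i, ∑ j, c i * c j * ⟪v i, z j⟫_ℝ ≤ μ * ∑ i, c i ^ 2) :
    ε * ⟪u, u⟫_ℝ ≤ (μ - 1) * ∑ i, ⟪v i, u⟫_ℝ ^ 2 := by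
  have h1 := (finiteRank_downdate_excess_two_sided A hsym hpos hε hu hz).1
  have h2 := hμ fun i => ⟪v i, u⟫_ℝ
  linarith

end Literature.Analysis.InnerProduct
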